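import Summits.KontsevichZagierPeriods.KontsevichZagierPeriods.Theses.FurushoPentagon
import Summits.KontsevichZagierPeriods.KontsevichZagierPeriods.Theorems.FurushoPentagonReducedPeriodRingDefs
import Summits.KontsevichZagierPeriods.KontsevichZagierPeriods.Theorems.FurushoPentagonReducedPeriodRingCubeAddCovSound
import Summits.KontsevichZagierPeriods.KontsevichZagierPeriods.Theorems.FurushoPentagonReducedPeriodRingCubeNewtonLeibnizSound
import Summits.KontsevichZagierPeriods.KontsevichZagierPeriods.Theorems.FurushoPentagonReducedPeriodRingCubeHalvingSound

/-!
# `ReducedPeriodRing`, line `effective-end-monoid`: soundness of the cubical sub-calculus and tame Fubini products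

Glue of the lead's skeleton for the crux `FurushoPentagon.ReducedPeriodRing`
(stmt-KontsevichZagierPeriods-3929), line `effective-end-monoid`, proved outright (no stubs):

* `stub_cubicalSound` / `cubeRelations_le_relations` — the relations of the cubical effective sub-calculus
  (`cubeRelations`, generated by the four cubical move families of
  `Theorems/FurushoPentagonReducedPeriodRingDefs.lean`) are Kontsevich–Zagier relations: the assembly
  of the landed stubs S2a `stub_cubeAddCov_sound`, S2b `stub_cubeNewtonLeibniz_sound`,
  S2c `stub_cubeHalving_sound` [Kontsevich–Zagier 2001, §1.2];
* `prod_cubical` — the Fubini product (`KZ.IntegralRep.prod`, [Kontsevich–Zagier 2001, §1.1: the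
  periods form a ring]) of two tame cube classes (domain the closed unit cube, integrand analytic on
  a neighbourhood of it) is again a tame cube class; this is what lets the skeleton apply the
  coherence stub S3 to `r ⊠ r`.

References: M. Kontsevich, D. Zagier, *Periods* (2001), §1.1–1.2; J. Ayoub, *Periods and the
conjectures of Grothendieck and Kontsevich–Zagier*, EMS Newsl. 91 (2014), Def. 6.
-/

noncomputable section

namespace Summit.KontsevichZagierPeriods.FurushoPentagon.ReducedPeriodRing

open Set
open Literature.NumberTheory.Transcendental Literature.NumberTheory.Transcendental.KZ

/-- **S2 (registered stub `stub_cubicalSound`): the cubical sub-calculus is sound** — every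
cubical relation is a Kontsevich–Zagier relation (S2a–c assembled over the generating move
families). [cite: KontsevichZagier2001, §1.2] -/
theorem stub_cubicalSound : cubeRelations ≤ relations := by
  refine (AddSubgroup.closure_le _).mpr ?_
  rintro c (((hc | hc) | hc) | hc)
  · exact stub_cubeAddCov_sound (Or.inl hc)
  · exact stub_cubeNewtonLeibniz_sound hc
  · exact stub_cubeAddCov_sound (Or.inr hc)
  · exact stub_cubeHalving_sound hc

/-- The cubical relations are Kontsevich–Zagier relations (the name used by the skeleton's
composition `ReducedPeriodRing_of`). [cite: KontsevichZagier2001, §1.2] -/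
theorem cubeRelations_le_relations : cubeRelations ≤ relations := stub_cubicalSound

/-- The product domain of two unit cubes is the unit cube. [folklore] -/
theorem prodDomain_eq_unitCube {n m : ℕ} (r : IntegralRep n) (s : IntegralRep m)
    (hr : r.domain = unitCube n) (hs : s.domain = unitCube m) :
    IntegralRep.prodDomain r s = unitCube (n + m) := by
  ext z
  simp only [IntegralRep.mem_prodDomain, hr, hs, mem_unitCube]
  constructor
  · rintro ⟨h1, h2⟩ i
    induction i using Fin.addCases with
    | left i => simpa using h1 i
    | right j => simpa using h2 j
  · intro h
    exact ⟨fun i => h _, fun j => h _⟩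

/-- Restriction to the first `n` coordinates maps the cube to the cube. [folklore] -/
theorem castAdd_mem_unitCube {n m : ℕ} {z : Fin (n + m) → ℝ} (hz : z ∈ unitCube (n + m)) :
    (fun i => z (Fin.castAdd m i)) ∈ unitCube n := fun _ => hz _

/-- Restriction to the last `m` coordinates maps the cube to the cube. [folklore] -/
theorem natAdd_mem_unitCube {n m : ℕ} {z : Fin (n + m) → ℝ} (hz : z ∈ unitCube (n + m)) :
    (fun j => z (Fin.natAdd n j)) ∈ unitCube m := fun _ => hz _

/-- `f ⊗ g` (`KZ.IntegralRep.prodFun`) is analytic on a neighbourhood of the cube when `f` and `g`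
are. [folklore] -/
theorem analyticOnNhd_prodFun {n m : ℕ} (r : IntegralRep n) (s : IntegralRep m)
    (hr : AnalyticOnNhd ℝ r.integrand (unitCube n)) (hs : AnalyticOnNhd ℝ s.integrand (unitCube m)) :
    AnalyticOnNhd ℝ (IntegralRep.prodFun r s) (unitCube (n + m)) := by
  -- the two coordinate restrictions are continuous linear, hence analytic everywhere
  let p₁ : (Fin (n + m) → ℝ) →L[ℝ] (Fin n → ℝ) :=
    ContinuousLinearMap.pi fun i => ContinuousLinearMap.proj (Fin.castAdd m i)
  let p₂ : (Fin (n + m) → ℝ) →L[ℝ] (Fin m → ℝ) :=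
    ContinuousLinearMap.pi fun j => ContinuousLinearMap.proj (Fin.natAdd n j)
  have h₁ : AnalyticOnNhd ℝ (fun z => r.integrand (p₁ z)) (unitCube (n + m)) :=
    hr.comp (p₁.analyticOnNhd _) fun z hz => castAdd_mem_unitCube hz
  have h₂ : AnalyticOnNhd ℝ (fun z => s.integrand (p₂ z)) (unitCube (n + m)) :=
    hs.comp (p₂.analyticOnNhd _) fun z hz => natAdd_mem_unitCube hz
  have hfun : IntegralRep.prodFun r s = fun z => r.integrand (p₁ z) * s.integrand (p₂ z) := by
    funext z
    simp [IntegralRep.prodFun, p₁, p₂]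
  rw [hfun]
  exact h₁.mul h₂

/-- **The Fubini product of two tame cube classes is a tame cube class**: its domain is the unit
cube and its integrand is analytic on a neighbourhood of it. [cite: KontsevichZagier2001, §1.1] -/
theorem prod_cubical {n m : ℕ} (r : IntegralRep n) (s : IntegralRep m)
    (hrd : r.domain = unitCube n) (hra : AnalyticOnNhd ℝ r.integrand (unitCube n))
    (hsd : s.domain = unitCube m) (hsa : AnalyticOnNhd ℝ s.integrand (unitCube m)) :
    (r.prod s).domain = unitCube (n + m) ∧
      AnalyticOnNhd ℝ (r.prod s).integrand (unitCube (n + m)) := by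
  refine ⟨?_, ?_⟩
  · rw [IntegralRep.prod_domain, prodDomain_eq_unitCube r s hrd hsd]
  · rw [IntegralRep.prod_integrand_eq]
    exact analyticOnNhd_prodFun r s hra hsa

/-- The tame cube classes are closed under the Fubini product inside `KZ.FormalRep`:
`[r] * [s] = [r ⊠ s]` is again a generator of `cubicalSpan`. [cite: KontsevichZagier2001, §1.1] -/
theorem of_mul_of_mem_cubicalGens {n m : ℕ} (r : IntegralRep n) (s : IntegralRep m)
    (hrd : r.domain = unitCube n) (hra : AnalyticOnNhd ℝ r.integrand (unitCube n))
    (hsd : s.domain = unitCube m) (hsa : AnalyticOnNhd ℝ s.integrand (unitCube m)) :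
    of r * of s ∈ cubicalGens := by
  obtain ⟨hd, ha⟩ := prod_cubical r s hrd hra hsd hsa
  exact ⟨n + m, r.prod s, hd, ha, by rw [of_mul_of]⟩

end Summit.KontsevichZagierPeriods.FurushoPentagon.ReducedPeriodRing

end
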